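import Literature.AlgebraicGeometry.Frobenioids.Thm42AssemblyOfPreSteps
import Literature.AlgebraicGeometry.Frobenioids.EquivalencePreStepsPerfect
import HarnessLib

/-!
# Frobenioids I, Theorem 4.2 (i)–(iii) AS TYPED, perfect-type case, with the hypotheses AS PRINTED —
# no Thm. 3.4 input and no revision of "FSMFF-type"

Mochizuki, *The geometry of Frobenioids I: the general theory*, Kyushu J. Math. **62** (2008) 293–400, §4,
Thm. 4.2, kurims pp. 77–81 [cite: MochizukiFrdI2008, Thm. 4.2 (ii) p.77]; Thm. 3.4 (ii) p. 62
[cite: MochizukiFrdI2008, Thm. 3.4 (ii) p.62].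

PROOF-ONLY file (seat abc-iut-w4-d093). `Thm42AssemblyOfPreSteps.lean` (abc-iut-L1-t11) builds the setting
`FrdI.T42.Setting` of the Thm. 4.2 proof from "`Ψ`, `Ψ⁻¹` preserve pre-steps" and closes the typed Thm. 4.2
(i)(ii)(iii) in the perfect-type case, discharging that input over bases of FSMFF-type in the REVISED (2024)
sense. Here the input is discharged WITHOUT the revision: for Frobenioids of PERFECT isotropic type,
pre-steps are preserved over bases of FSMFF-type AS PRINTED in 2008 (`FrdI.isPreStep_map_of_isOfPerfectType`,
`EquivalencePreStepsPerfect.lean` — in perfect type every irreducible morphism is a non-pre-step, so Prop. 1.14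
(ii) transports without Prop. 1.14 (iii)), and `Thm42Setting` (standard ∧ isotropic ∧ not group-like) supplies
through "standard type", clause (d), exactly that printed hypothesis. Results, for Frobenioids of PERFECT type
with `Φ_i` perf-factorial and ANY equivalence `Ψ`:
* `setting_of_perfectType_asPrinted` — `Thm42Setting ⟹ FrdI.T42.Setting F F₂ Ψ`;
* `thm42i_of_perfectType_asPrinted`, `thm42ii_of_perfectType_asPrinted`, `thm42iii_of_perfectType_asPrinted`,
  `thm42ii_iii_of_perfectType_asPrinted` — the typed `Thm42i`, `Thm42ii`, `Thm42iii e`, and (ii)+(iii) jointly,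
  with NO Thm. 3.4 / Thm. 4.2 hypothesis and NO base hypothesis beyond the typed statements' own `Thm42Setting`.
Honest residue (unchanged): print's Thm. 4.2 assumes standard (not perfect) type — the descent from `C^pf` is
row T42-L03 / sub-DAG S7. No new definition; nothing restated; nothing here bears on [IUTchIII] Cor. 3.12.
-/

namespace Literature.AlgebraicGeometry.Frobenioids

open CategoryTheory Opposite

universe w v v' u u'

namespace PreFrobenioidData

variable {D : Type u} [Category.{v} D] {Φ : Dᵒᵖ ⥤ CommMonCat.{w}} {C : Type u'} [Category.{v'} C]
  {F : C ⥤ ElemFrobenioid Φ}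
  {D₂ : Type u} [Category.{v} D₂] {Φ₂ : D₂ᵒᵖ ⥤ CommMonCat.{w}} {C₂ : Type u'} [Category.{v'} C₂]
  {F₂ : C₂ ⥤ ElemFrobenioid Φ₂} (Ψ : C ≌ C₂)

/-- **The setting of the proof of Thm. 4.2 from the PRINTED hypotheses, perfect-type case**: for Frobenioids of
perfect type with `Φ_i` perf-factorial, `Thm42Setting` (standard ∧ isotropic ∧ not group-like) supplies every
field of `FrdI.T42.Setting` — pre-steps preserved by `FrdI.isPreStep_map_of_isOfPerfectType` over the 2008
FSMFF bases of standard type (d). [cite: MochizukiFrdI2008, Thm. 3.4 (ii) p.62] -/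
theorem setting_of_perfectType_asPrinted (hF : PreFrobenioid.IsFrobenioid F) (hF₂ : PreFrobenioid.IsFrobenioid F₂)
    (hperf : PreFrobenioid.IsOfPerfectType F) (hperf₂ : PreFrobenioid.IsOfPerfectType F₂)
    (hpf : Objectwise (fun M _ => IsPerfFactorial M) Φ) (hpf₂ : Objectwise (fun M _ => IsPerfFactorial M) Φ₂)
    (hT : Thm42Setting (ofFunctor Φ F) (ofFunctor Φ₂ F₂)) : FrdI.T42.Setting F F₂ Ψ :=
  have histr : PreFrobenioid.IsOfIsotropicType F := (ofFunctor_isOfIsotropicType F).mp hT.isotropic.1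
  have histr₂ : PreFrobenioid.IsOfIsotropicType F₂ := (ofFunctor_isOfIsotropicType F₂).mp hT.isotropic.2
  setting_of_preservesPreSteps Ψ hF hF₂ hperf hperf₂ hpf hpf₂
    (fun _ _ _ hφ => FrdI.isPreStep_map_of_isOfPerfectType hF hF₂ histr histr₂ hperf hT.standard.2.fsmff Ψ hφ)
    (fun _ _ _ hφ =>
      FrdI.isPreStep_map_of_isOfPerfectType hF₂ hF histr₂ histr hperf₂ hT.standard.1.fsmff Ψ.symm hφ) hT

/-- **Theorem 4.2 (i) AS TYPED, perfect-type case, hypotheses as printed — NO Thm. 3.4 / Thm. 4.2 hypothesis and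
no base hypothesis beyond `Thm42Setting`.** [cite: MochizukiFrdI2008, Thm. 4.2 (i) p.77] -/
theorem thm42i_of_perfectType_asPrinted (hF : PreFrobenioid.IsFrobenioid F)
    (hF₂ : PreFrobenioid.IsFrobenioid F₂) (hperf : PreFrobenioid.IsOfPerfectType F)
    (hperf₂ : PreFrobenioid.IsOfPerfectType F₂) (hpf : Objectwise (fun M _ => IsPerfFactorial M) Φ)
    (hpf₂ : Objectwise (fun M _ => IsPerfFactorial M) Φ₂) : (ofFunctor Φ F).Thm42i (ofFunctor Φ₂ F₂) Ψ :=
  fun hT => thm42i_of_perfectSetting Ψ (setting_of_perfectType_asPrinted Ψ hF hF₂ hperf hperf₂ hpf hpf₂ hT) hT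

/-- **Theorem 4.2 (ii) AS TYPED, perfect-type case, hypotheses as printed.**
[cite: MochizukiFrdI2008, Thm. 4.2 (ii) p.77] -/
theorem thm42ii_of_perfectType_asPrinted (hF : PreFrobenioid.IsFrobenioid F)
    (hF₂ : PreFrobenioid.IsFrobenioid F₂) (hperf : PreFrobenioid.IsOfPerfectType F)
    (hperf₂ : PreFrobenioid.IsOfPerfectType F₂) (hpf : Objectwise (fun M _ => IsPerfFactorial M) Φ)
    (hpf₂ : Objectwise (fun M _ => IsPerfFactorial M) Φ₂) : (ofFunctor Φ F).Thm42ii (ofFunctor Φ₂ F₂) Ψ :=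
  fun hT => thm42ii_of_perfectSetting Ψ (setting_of_perfectType_asPrinted Ψ hF hF₂ hperf hperf₂ hpf hpf₂ hT) hT

/-- **Theorem 4.2 (iii) AS TYPED, perfect-type case, hypotheses as printed**, for ANY family `e` satisfying the
two clauses of (ii). [cite: MochizukiFrdI2008, Thm. 4.2 (iii) p.78] -/
theorem thm42iii_of_perfectType_asPrinted (hF : PreFrobenioid.IsFrobenioid F)
    (hF₂ : PreFrobenioid.IsFrobenioid F₂) (hperf : PreFrobenioid.IsOfPerfectType F)
    (hperf₂ : PreFrobenioid.IsOfPerfectType F₂) (hpf : Objectwise (fun M _ => IsPerfFactorial M) Φ)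
    (hpf₂ : Objectwise (fun M _ => IsPerfFactorial M) Φ₂)
    (e : ∀ A : C, Primes (Φ.obj (op (PreFrobenioid.baseObj F A))) ≃
      Primes (Φ₂.obj (op (PreFrobenioid.baseObj F₂ (Ψ.functor.obj A)))))
    (he : ∀ (A : C) (𝔭 : Primes (Φ.obj (op (PreFrobenioid.baseObj F A)))),
      (∀ ⦃B : C⦄ (φ : A ⟶ B), PreFrobenioid.IsCoAngularPreStep F φ →
          (PreFrobenioid.Div F φ ∈ 𝔭.submonoid ↔
            PreFrobenioid.Div F₂ (Ψ.functor.map φ) ∈ (e A 𝔭).submonoid)) ∧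
        ∀ ⦃B : C⦄ (ψ : B ⟶ A), PreFrobenioid.IsCoAngularPreStep F ψ →
          ((∃ y ∈ 𝔭.submonoid, Frobenioids.pull Φ (PreFrobenioid.Base F ψ) y = PreFrobenioid.Div F ψ) ↔
            ∃ y ∈ (e A 𝔭).submonoid, Frobenioids.pull Φ₂ (PreFrobenioid.Base F₂ (Ψ.functor.map ψ)) y =
              PreFrobenioid.Div F₂ (Ψ.functor.map ψ))) :
    (ofFunctor Φ F).Thm42iii (ofFunctor Φ₂ F₂) Ψ e := fun hT =>
  thm42iii_of_perfectSetting Ψ (setting_of_perfectType_asPrinted Ψ hF hF₂ hperf hperf₂ hpf hpf₂ hT) e he hT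

/-- **Theorem 4.2 (ii) and (iii) TOGETHER, perfect-type case, hypotheses as printed**: the unique family
`Ψ^Prime` of (ii) exists and, for IT, the monoid isomorphisms of (iii) exist at every Div-Frobenius-trivial
object — no family `e` assumed, no Thm. 3.4 input, no base revision.
[cite: MochizukiFrdI2008, Thm. 4.2 (ii)(iii) p.78] -/
theorem thm42ii_iii_of_perfectType_asPrinted (hF : PreFrobenioid.IsFrobenioid F)
    (hF₂ : PreFrobenioid.IsFrobenioid F₂) (hperf : PreFrobenioid.IsOfPerfectType F)
    (hperf₂ : PreFrobenioid.IsOfPerfectType F₂) (hpf : Objectwise (fun M _ => IsPerfFactorial M) Φ)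
    (hpf₂ : Objectwise (fun M _ => IsPerfFactorial M) Φ₂) (hT : Thm42Setting (ofFunctor Φ F) (ofFunctor Φ₂ F₂)) :
    ∃ e : ∀ A : C, Primes (Φ.obj (op (PreFrobenioid.baseObj F A))) ≃
        Primes (Φ₂.obj (op (PreFrobenioid.baseObj F₂ (Ψ.functor.obj A)))),
      (∀ (A : C) (𝔭 : Primes (Φ.obj (op (PreFrobenioid.baseObj F A)))),
        (∀ ⦃B : C⦄ (φ : A ⟶ B), PreFrobenioid.IsCoAngularPreStep F φ →
            (PreFrobenioid.Div F φ ∈ 𝔭.submonoid ↔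
              PreFrobenioid.Div F₂ (Ψ.functor.map φ) ∈ (e A 𝔭).submonoid)) ∧
          ∀ ⦃B : C⦄ (ψ : B ⟶ A), PreFrobenioid.IsCoAngularPreStep F ψ →
            ((∃ y ∈ 𝔭.submonoid, Frobenioids.pull Φ (PreFrobenioid.Base F ψ) y = PreFrobenioid.Div F ψ) ↔
              ∃ y ∈ (e A 𝔭).submonoid, Frobenioids.pull Φ₂ (PreFrobenioid.Base F₂ (Ψ.functor.map ψ)) y =
                PreFrobenioid.Div F₂ (Ψ.functor.map ψ))) ∧
      (ofFunctor Φ F).Thm42iii (ofFunctor Φ₂ F₂) Ψ e :=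
  have histr : PreFrobenioid.IsOfIsotropicType F := (ofFunctor_isOfIsotropicType F).mp hT.isotropic.1
  have histr₂ : PreFrobenioid.IsOfIsotropicType F₂ := (ofFunctor_isOfIsotropicType F₂).mp hT.isotropic.2
  thm42ii_iii_of_perfectType_of_preservesPreSteps Ψ hF hF₂ hperf hperf₂ hpf hpf₂
    (fun _ _ _ hφ => FrdI.isPreStep_map_of_isOfPerfectType hF hF₂ histr histr₂ hperf hT.standard.2.fsmff Ψ hφ)
    (fun _ _ _ hφ =>
      FrdI.isPreStep_map_of_isOfPerfectType hF₂ hF histr₂ histr hperf₂ hT.standard.1.fsmff Ψ.symm hφ) hT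

end PreFrobenioidData

end Literature.AlgebraicGeometry.Frobenioids
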